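import Summits.QuantumFields.BalabanUV.T4Continuum.Spine.NE1p.DressedTransportAssembledWitnessToy
import Summits.QuantumFields.BalabanUV.T4Continuum.Support.T4TrajectoryDensityFreshMargin

/-!
# T⁴ programme, spine estimate NE1′ (node O3b/H2) — NON-VACUITY OF END-F″∕END-F′ (DAG node N22), part 2 of 3: END-F″'s BINDERS
# ON THE DATUM (formalisation crew `b2b-balaban-t4-ne1p-formalise-*`, leaf seat 03, row W2)

ADDITIVE — imports part 1 `…DressedTransportAssembledWitnessToy` and the lineage's bond-ball complex margin
`Support/T4TrajectoryDensityFreshMargin` (p199894, for `hN2cx`) ONLY.  The module docstring of part 1 carries the WHY and the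
description of the datum, which govern this part verbatim.

THIS PART.  §3 the WEIGHT binders for the ACTION part `𝒜A k b = 𝒜₁ − 𝒬A k b` at BOTH met steps: `hB` (`realBaseAt_A`: at the
real reference the action part is real at both atoms — at step 1 because the dressed functional is real at real bond variables)
and `hE` (`exponentSliceAt_A_zero`: polynomial slice, oscillation `≤ (1/100)·20`; `exponentSliceAt_A_one`: THE DRESSED
FUNCTIONAL INSIDE THE EXPONENT — slice-holomorphy through `differentiableOn_Fn_one_chart` (closed form + `lamC` holomorphic on
`‖u‖ < 20`, the chart image staying in `‖u‖ ≤ 9`), oscillation `≤ (1/100)·8 + ‖c‖·4·91 ≤ ½`).  §4 the remaining binders: birth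
slices `hsl_A` (bound `190` on the radius-13 window along charts of radius `4`), the trajectory currency `hlin_A` (the toy's
`osc_ge`), THE FRESH PAIRS `relGauge_pair` (both atoms `z ∈ {0, z_H}` are in relative gauge with `V + z₁` along the declared
directions `∓z_H/2` of bound exactly `δf = 1/100`), the radius bookkeeping `hmargin_A` against the canonical `rsOf 4 ϱ`
(`ϱ_k < ϱ₁ k ≤ rs`), and `hSg_A`.

HONEST FRAMING.  Rung (B)+1 bookkeeping on ONE finite four-torus of fixed physical size — NOT infinite volume, NOT a mass
gap, NOT OS on ℝ⁴, NOT the Clay problem, NOT summit progress.  NE1′ is NOT PRINTED and NOT PROVED; every headline reads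
«NE1′ ⇐ the named binders» / «L-T ⇐ F-1…F-9»; spine PROVED 0∕9 unchanged.  A TOY: nothing of Bałaban's densities or of
[Balaban1989LargeFieldII] (1.71)–(1.75) pp. 379–380 is encoded (CONTEXT only, carried by the imported headers); no
`def … : Prop`; every declaration is [folklore] toy kernel mathematics, 0 sorry, 0 citations.  HONEST DEPENDENCY: continuum YM
on T⁴ ⇐ BetaPertH ∧ nine spine estimates (0/9 proved); BetaPertH ⇐ (D1) ∧ (D4) ∧ CAP+tail; G-an2-4 gates asym, D1 and NE2/3/4.
-/

noncomputable section

namespace Summit.QuantumFields.BalabanUV.T4Continuum.NE1p.DressedTransportAssembledWitness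

open MeasureTheory Set Metric Filter Finset
open scoped BigOperators
open Literature.MathematicalPhysics.QuantumFieldTheory.Balaban1983to89
open Literature.MathematicalPhysics.QuantumFieldTheory.Balaban1983to89.T4TermFormat
open Literature.MathematicalPhysics.QuantumFieldTheory.Balaban1983to89.T4TermFormat.Booking
open Literature.MathematicalPhysics.QuantumFieldTheory.Balaban1983to89.T4GatedBooking
open Literature.MathematicalPhysics.QuantumFieldTheory.Balaban1983to89.T4TrajectoryComparison
open T4TrajectoryModulus (bondBall bondBall_add_mem bondBall_latMove_add_mem bondBall_diam)
open T4BlockTransport (Fld NDir latMove latN Site norm_dir_le)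
open T4BirthChartTransport (GaugeInvariant BirthSlice RelGauge)
open T4TrajectoryDensity
open Summit.QuantumFields.BalabanUV.T4Continuum.T4TrajectoryDensityDressed
open Summit.QuantumFields.BalabanUV.T4Continuum.T4TrajectoryDensityWitness
open Summit.QuantumFields.BalabanUV.T4Continuum.NE1p.DressedRoot
open Summit.QuantumFields.BalabanUV.T4Continuum.NE1p.DressedTransportAssembledData

/-! ## §3 END-F″'s weight binders on the datum: `hB`/`hE` for the action part at BOTH met steps [folklore] -/

/-- The action part along a chart against the reference, step `0`: the `Fn 0 0`-difference is background-free and cancels;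
what is left is an explicit coefficient times the complex displacement. [arith] [folklore] -/
theorem 𝒜A_zero_latMove_sub_ref (b : Bk.Birth) (U₀ : Fld 4 ℂ) (p : NDir 4 ℂ) (t : ℂ) (z : Fld 4 ℂ) :
    𝒜A 0 b (latMove U₀ p t) z - 𝒜A 0 b (ref₁ U₀) z =
      (((1 / 10 : ℝ) : ℂ) * ev₀₀ z - ((1 / 100 : ℝ) : ℂ)) * (ev₀₀ U₀ + t * ev₀₀ p.1.1 - (((ev₀₀ U₀).re : ℝ) : ℂ)) := by
  rw [𝒜A, 𝒜A, 𝒬A_zero, 𝒬A_zero]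
  simp only [𝒜₁, qA, ev₀₀_latMove, ev₀₀_ref₁]
  ring

/-- Step `1`: the same displacement term plus `c ×` a four-term combination of values of the dressed functional. [arith] [folklore] -/
theorem 𝒜A_one_latMove_sub_ref (b : Bk.Birth) (U₀ : Fld 4 ℂ) (p : NDir 4 ℂ) (t : ℂ) (z : Fld 4 ℂ) :
    𝒜A 1 b (latMove U₀ p t) z - 𝒜A 1 b (ref₁ U₀) z =
      (((1 / 10 : ℝ) : ℂ) * ev₀₀ z - ((1 / 100 : ℝ) : ℂ)) * (ev₀₀ U₀ + t * ev₀₀ p.1.1 - (((ev₀₀ U₀).re : ℝ) : ℂ)) -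
        cA * ((Fn 0 1 (latMove U₀ p t + z) - Fn 0 1 (latMove U₀ p t + z₁A)) -
          (Fn 0 1 (ref₁ U₀ + z) - Fn 0 1 (ref₁ U₀ + z₁A))) := by
  rw [𝒜A, 𝒜A, 𝒬A_one, 𝒬A_one]
  simp only [𝒜₁, qA, ev₀₀_latMove, ev₀₀_ref₁]
  ring

/-- The displacement coefficient is at most `1/100` at both atoms. [arith] [folklore] -/
theorem norm_coeffA_le (z : Fld 4 ℂ) (hz : z = 0 ∨ z = atomH) :
    ‖((1 / 10 : ℝ) : ℂ) * ev₀₀ z - ((1 / 100 : ℝ) : ℂ)‖ ≤ 1 / 100 := by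
  rcases hz with rfl | rfl
  · rw [ev₀₀_zero, mul_zero, zero_sub, norm_neg, Complex.norm_real, Real.norm_eq_abs]
    norm_num
  · rw [ev₀₀_atomH, show ((1 / 10 : ℝ) : ℂ) * ((1 / 50 : ℝ) : ℂ) - ((1 / 100 : ℝ) : ℂ) =
      (((1 / 10 * (1 / 50) - 1 / 100 : ℝ)) : ℂ) by push_cast; ring, Complex.norm_real, Real.norm_eq_abs]
    norm_num

/-- The complex displacement along a chart of radius `6/N` from a window of radius `ρ`: `≤ 2ρ + 6`. [arith] [folklore] -/
theorem norm_displacement_le {ρ : ℝ} {U₀ : Fld 4 ℂ} (hU₀ : U₀ ∈ (bondBall 4 ρ : Set (Fld 4 ℂ))) (p : NDir 4 ℂ)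
    (hp : 0 < latN p) {t : ℂ} (ht : t ∈ ball (0 : ℂ) (6 / latN p)) :
    ‖ev₀₀ U₀ + t * ev₀₀ p.1.1 - (((ev₀₀ U₀).re : ℝ) : ℂ)‖ ≤ 2 * ρ + 6 := by
  have hu : ‖ev₀₀ U₀‖ ≤ ρ := hU₀ 0 0
  have h6 := norm_t_mul_le p hp ht
  have hre : ‖(((ev₀₀ U₀).re : ℝ) : ℂ)‖ ≤ ρ := by
    rw [Complex.norm_real, Real.norm_eq_abs]; exact (Complex.abs_re_le_norm _).trans hu
  calc _ ≤ ‖ev₀₀ U₀ + t * ev₀₀ p.1.1‖ + ‖(((ev₀₀ U₀).re : ℝ) : ℂ)‖ := norm_sub_le _ _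
    _ ≤ (‖ev₀₀ U₀‖ + ‖t * ev₀₀ p.1.1‖) + ‖(((ev₀₀ U₀).re : ℝ) : ℂ)‖ := by gcongr; exact norm_add_le _ _
    _ ≤ (ρ + 6) + ρ := by gcongr
    _ = 2 * ρ + 6 := by ring

/-- `hB` at BOTH met steps: `base₁ ≡ 1 ≥ 0` with full support; at the real reference `Re U₀` of a window point (`‖U₀₀‖ ≤ 7`)
the action part is REAL at both atoms — at step `1` because the dressed functional is real at real bond variables
(`Fn_one_im_of_real`). [folklore] -/
theorem realBaseAt_A {k : ℕ} (hk : k ≤ 1) (b : Bk.Birth) {ρ : ℝ} (hρ : ρ ≤ 7) :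
    RealBaseAt ref₁ base₁ (𝒜A k b) flTwo (bondBall 4 ρ) := by
  refine ⟨Eventually.of_forall fun _ => zero_le_one, ?_, fun U₀ hU₀ => ⟨aesm_two _, ?_, integrable_two _⟩⟩
  · rw [show Function.support base₁ = univ from Function.support_const one_ne_zero]
    simp [flTwo]
  · have hu : |(ev₀₀ U₀).re| ≤ 7 := (Complex.abs_re_le_norm _).trans ((hU₀ 0 0).trans hρ)
    interval_cases k
    · rw [ae_two]
      simp only [𝒜A, 𝒬A_zero]
      simp [𝒜₁, qA, ev₀₀_ref₁, cA, Complex.mul_im, Complex.mul_re]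
    · have hF : ∀ z : Fld 4 ℂ, (z = 0 ∨ z = atomH ∨ z = z₁A) → (Fn 0 1 (ref₁ U₀ + z)).im = 0 := by
        intro z hz
        have hz' : ∃ y : ℝ, ev₀₀ z = (y : ℂ) ∧ |y| ≤ 1 := by
          rcases hz with rfl | rfl | rfl
          · exact ⟨0, by simp, by norm_num⟩
          · exact ⟨1 / 50, by simp, by norm_num⟩
          · exact ⟨1 / 100, by simp, by norm_num⟩
        obtain ⟨y, hy, hy1⟩ := hz'
        refine Fn_one_im_of_real (x := (ev₀₀ U₀).re + y) (by rw [ev₀₀_add, ev₀₀_ref₁, hy]; push_cast; ring) ?_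
        exact (abs_add_le _ _).trans (by linarith)
      have hF0 : (Fn 0 1 (ref₁ U₀)).im = 0 := by simpa using hF 0 (Or.inl rfl)
      rw [ae_two]
      simp only [𝒜A, 𝒬A_one]
      simp [𝒜₁, qA, ev₀₀_ref₁, cA, Complex.mul_im, Complex.mul_re, hF0, hF atomH (Or.inr (Or.inl rfl)),
        hF z₁A (Or.inr (Or.inr rfl))]

/-- Along a chart of radius `6/N` from a window point with `‖U₀₀‖ ≤ 1`, shifted by a fluctuation of size `≤ 1`, the bond
variable stays in the disc of radius `9 < 20` where the dressed functional has its closed form. [arith] [folklore] -/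
theorem norm_ev₀₀_chart_le {U₀ : Fld 4 ℂ} (hU₀ : ‖ev₀₀ U₀‖ ≤ 1) (p : NDir 4 ℂ) (hp : 0 < latN p) {t : ℂ}
    (ht : t ∈ ball (0 : ℂ) (6 / latN p)) {z : Fld 4 ℂ} (hz : ‖ev₀₀ z‖ ≤ 1) :
    ‖ev₀₀ (latMove U₀ p t + z)‖ ≤ 9 := by
  rw [ev₀₀_add, ev₀₀_latMove]
  have h6 := norm_t_mul_le p hp ht
  calc _ ≤ ‖ev₀₀ U₀ + t * ev₀₀ p.1.1‖ + ‖ev₀₀ z‖ := norm_add_le _ _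
    _ ≤ (‖ev₀₀ U₀‖ + ‖t * ev₀₀ p.1.1‖) + ‖ev₀₀ z‖ := by gcongr; exact norm_add_le _ _
    _ ≤ (1 + 6) + 1 := by gcongr
    _ ≤ 9 := by norm_num

/-- SLICE-HOLOMORPHY OF THE DRESSED FUNCTIONAL: `t ↦ Fn 0 1 (U₀ + t·p + z)` is complex differentiable on the chart disc
`‖t‖ < 6/N` (`‖U₀₀‖ ≤ 1`, `‖z₀₀‖ ≤ 1`): there it is `10·(affine) + lamC(affine)/5` with the affine image inside `‖u‖ < 20`,
where the logistic weight is holomorphic (`differentiableOn_lamC`). [folklore] -/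
theorem differentiableOn_Fn_one_chart {U₀ : Fld 4 ℂ} (hU₀ : ‖ev₀₀ U₀‖ ≤ 1) (p : NDir 4 ℂ) (hp : 0 < latN p)
    {z : Fld 4 ℂ} (hz : ‖ev₀₀ z‖ ≤ 1) :
    DifferentiableOn ℂ (fun t : ℂ => Fn 0 1 (latMove U₀ p t + z)) (ball (0 : ℂ) (6 / latN p)) := by
  have haff : DifferentiableOn ℂ (fun t : ℂ => ev₀₀ (latMove U₀ p t + z)) (ball (0 : ℂ) (6 / latN p)) := by
    simp only [ev₀₀_add, ev₀₀_latMove]; fun_prop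
  have hmaps : MapsTo (fun t : ℂ => ev₀₀ (latMove U₀ p t + z)) (ball (0 : ℂ) (6 / latN p)) (ball (0 : ℂ) 20) :=
    fun t ht => by
      rw [mem_ball, dist_zero_right]
      linarith [norm_ev₀₀_chart_le hU₀ p hp ht hz]
  have hd : DifferentiableOn ℂ
      (fun t : ℂ => 10 * ev₀₀ (latMove U₀ p t + z) + lamC (ev₀₀ (latMove U₀ p t + z)) * (1 / 5))
      (ball (0 : ℂ) (6 / latN p)) :=
    (haff.const_mul (10 : ℂ)).add ((differentiableOn_lamC.comp haff hmaps).mul_const (1 / 5))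
  refine hd.congr fun t ht => ?_
  rw [Fn_one_of_le ((norm_ev₀₀_chart_le hU₀ p hp ht hz).trans (by norm_num)), lam₁_eq_lamC]

/-- Slice-holomorphy of the step-1 ACTION part along a chart (`‖U₀₀‖ ≤ 1`, fluctuation `‖z₀₀‖ ≤ 1`): polynomial part plus
`c ×` two slice-holomorphic values of the dressed functional. [folklore] -/
theorem differentiableOn_𝒜A_one (b : Bk.Birth) {U₀ : Fld 4 ℂ} (hU₀ : ‖ev₀₀ U₀‖ ≤ 1) (p : NDir 4 ℂ) (hp : 0 < latN p)
    {z : Fld 4 ℂ} (hz : ‖ev₀₀ z‖ ≤ 1) :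
    DifferentiableOn ℂ (fun t : ℂ => 𝒜A 1 b (latMove U₀ p t) z) (ball (0 : ℂ) (6 / latN p)) := by
  have hz1 : ‖ev₀₀ z₁A‖ ≤ 1 := by rw [ev₀₀_z₁A, Complex.norm_real]; norm_num
  have h1 := differentiableOn_Fn_one_chart hU₀ p hp hz
  have h2 := differentiableOn_Fn_one_chart hU₀ p hp hz1
  have hpoly : DifferentiableOn ℂ
      (fun t : ℂ => ((1 / 10 : ℝ) : ℂ) * ev₀₀ (latMove U₀ p t) * ev₀₀ z - ((1 / 100 : ℝ) : ℂ) * ev₀₀ (latMove U₀ p t))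
      (ball (0 : ℂ) (6 / latN p)) := by
    simp only [ev₀₀_latMove]; fun_prop
  have hobs : DifferentiableOn ℂ
      (fun t : ℂ => cA * (Fn 0 1 (latMove U₀ p t + z) - Fn 0 1 (latMove U₀ p t + z₁A))) (ball (0 : ℂ) (6 / latN p)) :=
    (h1.sub h2).const_mul cA
  have e : (fun t : ℂ => 𝒜A 1 b (latMove U₀ p t) z) = fun t =>
      (((1 / 10 : ℝ) : ℂ) * ev₀₀ (latMove U₀ p t) * ev₀₀ z - ((1 / 100 : ℝ) : ℂ) * ev₀₀ (latMove U₀ p t)) -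
        cA * (Fn 0 1 (latMove U₀ p t + z) - Fn 0 1 (latMove U₀ p t + z₁A)) := by
    funext t
    rw [𝒜A, 𝒬A_one, 𝒜₁, qA]
    ring
  rw [e]
  exact hpoly.sub hobs

/-- `hE` AT STEP 0 on a window of radius `≤ 7`: `Ω = ball 0 (6/N)`, a polynomial slice, oscillation `≤ (1/100)·20 ≤ ½`. [folklore] -/
theorem exponentSliceAt_A_zero (b : Bk.Birth) {ρ : ℝ} (hρ : ρ ≤ 7) :
    ExponentSliceAt ref₁ (𝒜A 0 b) flTwo latMove latN (bondBall 4 ρ) 1 (ϱA 0) (1 / 2) := by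
  intro U₀ hU₀ p hp hp1
  refine ⟨ball 0 (6 / latN p), isOpen_ball, discs_subset_ball hp hp1 (by norm_num [ϱA]), fun t _ => aesm_two _,
    Eventually.of_forall fun z => ?_, ae_two.mpr ⟨fun t ht => ?_, fun t ht => ?_⟩⟩
  · show DifferentiableOn ℂ (fun t => 𝒜A 0 b (latMove U₀ p t) z) _
    simp only [𝒜A, 𝒬A_zero, 𝒜₁, qA, ev₀₀_latMove]
    fun_prop
  all_goals
    have hn := norm_displacement_le hU₀ p hp ht
    rw [𝒜A_zero_latMove_sub_ref, norm_mul]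
  · calc _ ≤ (1 / 100 : ℝ) * (2 * ρ + 6) :=
          mul_le_mul (norm_coeffA_le 0 (Or.inl rfl)) hn (norm_nonneg _) (by norm_num)
      _ ≤ 1 / 2 := by linarith
  · calc _ ≤ (1 / 100 : ℝ) * (2 * ρ + 6) :=
          mul_le_mul (norm_coeffA_le atomH (Or.inr rfl)) hn (norm_nonneg _) (by norm_num)
      _ ≤ 1 / 2 := by linarith

/-- `hE` AT STEP 1 on a window of radius `≤ 1` — THE DRESSED FUNCTIONAL INSIDE THE EXPONENT: `Ω = ball 0 (6/N)`, holomorphy by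
`differentiableOn_Fn_one_chart`, oscillation `≤ (1/100)·8 + ‖c‖·4·91 ≤ ½` (`‖Fn 0 1‖ ≤ 10·9 + 3/25` on the relevant discs). [folklore] -/
theorem exponentSliceAt_A_one (b : Bk.Birth) {ρ : ℝ} (hρ : ρ ≤ 1) :
    ExponentSliceAt ref₁ (𝒜A 1 b) flTwo latMove latN (bondBall 4 ρ) 1 (ϱA 1) (1 / 2) := by
  intro U₀ hU₀ p hp hp1
  have hu : ‖ev₀₀ U₀‖ ≤ 1 := (hU₀ 0 0).trans hρ
  have hz0 : ‖ev₀₀ (0 : Fld 4 ℂ)‖ ≤ 1 := by simp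
  have hzH : ‖ev₀₀ atomH‖ ≤ 1 := by rw [ev₀₀_atomH, Complex.norm_real]; norm_num
  have hz1 : ‖ev₀₀ z₁A‖ ≤ 1 := by rw [ev₀₀_z₁A, Complex.norm_real]; norm_num
  -- the four values of the dressed functional entering the difference are at bond variables of norm ≤ 9
  have hFle : ∀ {V : Fld 4 ℂ}, ‖ev₀₀ V‖ ≤ 9 → ‖Fn 0 1 V‖ ≤ 91 := fun hV =>
    (norm_Fn_one_le (hV.trans (by norm_num))).trans (by linarith)
  have hrefz : ∀ {z : Fld 4 ℂ}, ‖ev₀₀ z‖ ≤ 1 → ‖ev₀₀ (ref₁ U₀ + z)‖ ≤ 9 := fun {z} hz => by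
    rw [ev₀₀_add, ev₀₀_ref₁]
    have hre : ‖(((ev₀₀ U₀).re : ℝ) : ℂ)‖ ≤ 1 := by
      rw [Complex.norm_real, Real.norm_eq_abs]; exact (Complex.abs_re_le_norm _).trans hu
    exact (norm_add_le _ _).trans (by linarith)
  refine ⟨ball 0 (6 / latN p), isOpen_ball, discs_subset_ball hp hp1 (by norm_num [ϱA]), fun t _ => aesm_two _,
    ae_two.mpr ⟨?_, ?_⟩, ae_two.mpr ⟨fun t ht => ?_, fun t ht => ?_⟩⟩
  · exact differentiableOn_𝒜A_one b hu p hp hz0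
  · exact differentiableOn_𝒜A_one b hu p hp hzH
  all_goals
    have hn := norm_displacement_le hU₀ p hp ht
    have hc4 : ∀ {z : Fld 4 ℂ}, ‖ev₀₀ z‖ ≤ 1 →
        ‖cA * ((Fn 0 1 (latMove U₀ p t + z) - Fn 0 1 (latMove U₀ p t + z₁A)) -
          (Fn 0 1 (ref₁ U₀ + z) - Fn 0 1 (ref₁ U₀ + z₁A)))‖ ≤ 1 / 67108864 * (91 + 91 + (91 + 91)) := fun {z} hz => by
      rw [norm_mul, norm_cA]
      refine mul_le_mul_of_nonneg_left ((norm_sub_le _ _).trans (add_le_add ((norm_sub_le _ _).trans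
        (add_le_add (hFle (norm_ev₀₀_chart_le hu p hp ht hz)) (hFle (norm_ev₀₀_chart_le hu p hp ht hz1))))
        ((norm_sub_le _ _).trans (add_le_add (hFle (hrefz hz)) (hFle (hrefz hz1)))))) (by norm_num)
    rw [𝒜A_one_latMove_sub_ref]
    refine (norm_sub_le _ _).trans ?_
    rw [norm_mul]
  · calc _ ≤ (1 / 100 : ℝ) * (2 * ρ + 6) + 1 / 67108864 * (91 + 91 + (91 + 91)) :=
          add_le_add (mul_le_mul (norm_coeffA_le 0 (Or.inl rfl)) hn (norm_nonneg _) (by norm_num)) (hc4 hz0)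
      _ ≤ 1 / 2 := by linarith
  · calc _ ≤ (1 / 100 : ℝ) * (2 * ρ + 6) + 1 / 67108864 * (91 + 91 + (91 + 91)) :=
          add_le_add (mul_le_mul (norm_coeffA_le atomH (Or.inr rfl)) hn (norm_nonneg _) (by norm_num)) (hc4 hzH)
      _ ≤ 1 / 2 := by linarith


/-! ## §4 The remaining binders: birth slices, trajectory currency, fresh pairs, radii, live generations [folklore] -/

/-- `hsl`: the birth slices on the radius-13 window along charts of radius `r = 4`: `Dm = ball 0 (6/N)`, bound
`|10·(U₀₀ + t·p₀₀)| ≤ 10·(13 + 6) = 190`; the absent later generations are `0`. [folklore] -/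
theorem hsl_A (b : Bk.Birth) (k' : ℕ) (Gate : ℕ → Prop) (_hb : Bk.birthScale b ≤ k') (_hk : k' ≤ Bk.K) (_hran : RanBelow Gate k') :
    BirthSlice (Fn k' k') latMove latN (WinA k') 1 4 (TrA.gen b k') := by
  intro U hU p hp hp1
  rw [Fn_self]
  show ∃ Dm : Set ℂ, DifferentiableOn ℂ (fun t : ℂ => birth k' (latMove U p t)) Dm ∧
      (∀ t ∈ Dm, ‖birth k' (latMove U p t)‖ ≤ genA k') ∧ ∀ s ∈ Icc (0 : ℝ) 1, closedBall (s : ℂ) (4 / latN p) ⊆ Dm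
  by_cases hk : k' = 0
  · subst hk
    have hU13 : ‖ev₀₀ U‖ ≤ 13 := by simpa [radA, ev₀₀] using hU 0 0
    refine ⟨ball 0 (6 / latN p), ?_, fun t ht => ?_, discs_subset_ball hp hp1 (by norm_num)⟩
    · simp only [birth, ↓reduceIte, ev₀₀_latMove]; fun_prop
    · simp only [birth, ↓reduceIte, ev₀₀_latMove, genA]
      have h6 := norm_t_mul_le p hp ht
      calc ‖10 * (ev₀₀ U + t * ev₀₀ p.1.1)‖ = 10 * ‖ev₀₀ U + t * ev₀₀ p.1.1‖ := by rw [norm_mul]; simp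
        _ ≤ 10 * (‖ev₀₀ U‖ + ‖t * ev₀₀ p.1.1‖) := by gcongr; exact norm_add_le _ _
        _ ≤ 190 := by linarith
  · exact ⟨univ, by simp only [birth, if_neg hk]; fun_prop, fun t _ => by simp [birth, hk, genA], fun _ _ => subset_univ _⟩

/-- `hlin`: THE TRAJECTORY CURRENCY FROM THE DRESSED FUNCTIONALS (the toy's `osc_ge`): at `k′ = 0`, `k ≤ 2`, base `0 ∈ WinA k`,
gauge image `U₁ = (1/5)·e₀₀` (defect `1/5`), `lin = 1 ≤ 6/5 ≤ ‖Fn 0 k U₁ − Fn 0 k 0‖`; `k′ ≥ 1`: `lin = 0`. [folklore] -/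
theorem hlin_A (b : Bk.Birth) (k' k : ℕ) (Gate : ℕ → Prop) (_hb : Bk.birthScale b ≤ k') (_hk'k : k' ≤ k) (hk : k ≤ Bk.K)
    (_hran : RanBelow Gate k) :
    ∀ ε > 0, ∃ U₀ ∈ WinA k, ∃ U₁ : Fld 4 ℂ, RelGauge (fun U U' : Fld 4 ℂ => U = U') latMove latN U₀ U₁ (1 / 5 : ℝ) ∧
      TrA.lin b k' k ≤ ‖Fn k' k U₁ - Fn k' k U₀‖ + ε := by
  intro ε hε
  have hk2 : k ≤ 2 := hk
  refine ⟨0, zero_mem_WinA hk2, latMove 0 dir5 1, ⟨dir5, by show (0 : ℝ) < 1 / 5; norm_num, le_rfl, rfl⟩, ?_⟩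
  show linT k' ≤ _
  by_cases hk' : k' = 0
  · subst hk'
    have h1 : ev₀₀ (latMove 0 dir5 1) = 1 / 5 := by simp [ev₀₀_latMove, dir5, fldDir]
    have := osc_ge hk2 h1
    simp only [linT, ↓reduceIte]; linarith
  · simp only [linT, if_neg hk']; positivity

/-- The fresh-pair direction `z − z₁` for the atom `z = 0`: the constant field `−1/100`, declared bound `1/100`. [folklore] -/
def dirM : NDir 4 ℂ := fldDir (fun _ _ => -(((1 / 100 : ℝ)) : ℂ)) (1 / 100) fun _ _ => by
  rw [norm_neg, Complex.norm_real]; norm_num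

/-- The fresh-pair direction `z − z₁` for the atom `z = z_H`: the constant field `+1/100`, declared bound `1/100`. [folklore] -/
def dirP : NDir 4 ℂ := fldDir (fun _ _ => ((1 / 100 : ℝ) : ℂ)) (1 / 100) fun _ _ => by
  rw [Complex.norm_real]; norm_num

/-- **THE FRESH PAIRS** (`hpairx`): for every configuration `V`, BOTH atoms `z ∈ {0, z_H}` are in relative gauge with `V + z₁`
with defect `1/100`: `V + z = (V + z₁) + (z − z₁)` along the declared direction `z − z₁` of bound exactly `1/100`. [folklore] -/
theorem relGauge_pair (V z : Fld 4 ℂ) (hz : z = 0 ∨ z = atomH) :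
    RelGauge (fun U U' : Fld 4 ℂ => U = U') latMove latN (V + z₁A) (V + z) δfA := by
  rcases hz with rfl | rfl
  · refine ⟨dirM, by show (0 : ℝ) < 1 / 100; norm_num, le_of_eq (show (1 / 100 : ℝ) = 1 / 100 from rfl), ?_⟩
    funext x ν
    simp only [Pi.add_apply, Pi.zero_apply, T4BlockTransport.latMove, z₁A, dirM, fldDir, one_smul]
    ring
  · refine ⟨dirP, by show (0 : ℝ) < 1 / 100; norm_num, le_of_eq (show (1 / 100 : ℝ) = 1 / 100 from rfl), ?_⟩
    funext x ν
    simp only [Pi.add_apply, T4BlockTransport.latMove, z₁A, dirP, fldDir, one_smul, atomH]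
    push_cast
    ring

/-- `hmargin`: chart radius < margin radius ≤ the live generation's current slice radius (`rsOf 4 ϱ`), at every step. [folklore] -/
theorem hmargin_A (b : Bk.Birth) (k : ℕ) :
    ϱA k < ϱ₁A k ∧ 0 < ϱ₁A k ∧
      ∀ p ∈ SgA k b, ϱ₁A k ≤ rsOf 4 (fun (_ : Bk.Birth) (_ k : ℕ) => ϱA k) p.1 p.2 k := by
  refine ⟨ϱA_lt_ϱ₁A k, ϱ₁A_pos k, fun p hp => ?_⟩
  unfold SgA at hp
  split_ifs at hp with hk
  · rw [Finset.mem_singleton] at hp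
    subst hp
    interval_cases k
    · simp [ϱ₁A, rsOf]
    · rw [show rsOf 4 (fun (_ : Bk.Birth) (_ k : ℕ) => ϱA k) b 0 1 = ϱA 0 from rsOf_succ 4 _ b le_rfl]
      norm_num [ϱ₁A, ϱA]
  · simp at hp

/-- `hSg`: live generations belong to live families, are born, and are not from the future. [folklore] -/
theorem hSg_A (k : ℕ) (b : Bk.Birth) : ∀ p ∈ SgA k b, p.1 ∈ SA k b ∧ Bk.birthScale p.1 ≤ p.2 ∧ p.2 ≤ k := by
  intro p hp
  unfold SgA at hp
  split_ifs at hp with hk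
  · rw [Finset.mem_singleton] at hp
    subst hp
    refine ⟨?_, le_rfl, Nat.zero_le k⟩
    show b ∈ SA k b
    rw [SA, if_pos (by omega)]
    exact Finset.mem_singleton_self b
  · simp at hp

end Summit.QuantumFields.BalabanUV.T4Continuum.NE1p.DressedTransportAssembledWitness

end
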